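import Mathlib.Analysis.SpecialFunctions.Complex.Arg
import Mathlib.Algebra.Order.Floor.Semiring
import Literature.Probability.LatticeModels.IsoradialGraphsProofs
import Literature.Probability.RandomPlanarGeometry.FaceDGFF
import HarnessLib

/-!
# The flow-line dressing of a lattice path

Imaginary-geometry boundary data on the faces beside a vertex sequence of `δℤ²`, extended
discretely harmonically into the slit face domain, and the dressing defect of a coupling
(definition request `defn-flowLineDressing` of route `CriticalPhenomena/SAWScalingLimit/
SAWDiscreteFlowLine`: the shared `let` preamble `lf/rf/Ed/K/jf/bl/pt/ang/dat/U/dfc/dft` of its cruxes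
`LatticeFlowLine`, `FlowLineStability`, `GaussianDressing`; also wanted by the cards
`imaginary-geometry-winding-dirichlet`, `tilted-harmonic-explorer`). Companion of `FaceDGFF.lean`
(`faceDomain`, `faceCentre`, `faceExit`, `facePairing`, `faceQuadForm` = `Fc/ctr/Hm/pr/Qv`).

## The continuum statement being transcribed

Miller–Sheffield, *Imaginary geometry I* (PTRF 164 (2016) = arXiv:1201.1496), Thm. 1.1 with §1.2
(Fig. 1.9–1.10; p. 7 of the arXiv text): for a GFF `h` on `(ℍ; 0, ∞)` with boundary data `−λ` on
`ℝ₋`, `λ` on `ℝ₊` coupled with its flow line `η ∼ SLE_κ` from `0`, "along the path one has `−λ'`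
plus the winding on the left and `λ'` plus the winding on the right": given `η[0,τ]` the field is a
GFF on `ℍ ∖ η[0,τ]` with data `−λ' + χ·winding` / `λ' + χ·winding` on the left / right side of the
path (`λ = π/√κ`, `λ' = λ − πχ/2 = π√κ/4`, `χ = 2/√κ − √κ/2`; winding of the unit tangent, started
vertical: "Each time the path makes a quarter turn to the left, heights go up by `πχ/2`"). With
`h = h⁰ + 𝔥₀`, `h⁰` a ZERO-boundary GFF and `𝔥₀(z) = λ − (2λ/π) arg z` (bounded harmonic, data `∓λ`,
Fig. 1.10), the conditional mean of `h⁰` is harmonic on the slit domain with data `0` on `∂ℍ` and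
`∓λ' + χ·winding − 𝔥₀` on the two sides of the path. In a Dobrushin domain `(D; a, b)` everything
is read in the `ℍ`-chart `w = φ⁻¹` of a chordal uniformizer `φ : ℍ → D` (so the coordinate-change
term `−χ arg (φ⁻¹)'` of [MS16, Fig. 1.6] never appears; two uniformizers differ by a dilation of
`ℍ`, which nothing below sees: `FlowLineFrame.smulChart_dressing`).

## The lattice transcription (route SAWDiscreteFlowLine) — contents

A lattice path is a vertex sequence `v : ℕ → ℤ²` (a walk of `Ω_δ` frozen after its last step).
Faces are indexed by their lower-left corner (`FaceDGFF.lean`); the face LEFT of the directed edge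
`x → y` is the tree's `squareLeftFace x y` (`IsoradialGraphs.lean`; east `x`, north `x − e₀`, west
`x − e₀ − e₁`, south `x − e₁`), the face RIGHT of it is `squareLeftFace y x` (east `x − e₁`, north
`x`, west `x − e₀`, south `x − e₀ − e₁`) — the case tables `lf`, `rf` of the cruxes on lattice edges;
`faceCentre_squareLeftFace[_symm]` certify the orientation (centre = midpoint `± i·(half edge)`).
* `IsSideFace` (`Ed`), `sideFaces` (`K`), `firstSideIndex` (`jf`; `sInf`, junk `0`), `sideSign`
  (`−1` iff the face is LEFT of its first step), `blockSteps δ = ⌈δ^{-1/2}⌉` (`bl`).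
* `FlowLineFrame`: the constants `(λ, λ', χ)` AS PARAMETERS (as requested; `κ = 8/3`:
  `(π√(3/8), π/√6, 1/√6)`, LERW control `κ = 2`: `(π/√2, π√2/4, 1/√2)`), the chart `w` (`= φ.symm`),
  the domain (`= D.carrier`), the mesh `δ`, the block length `m` (`= bl δ`); on it `chordVertex`
  (`pt`), the LIFTED chord angle `chordAngle` (`ang`: first chord relative to the upward vertical,
  then principal turning increments — a real winding, not an angle mod `2π`),
  `halfPlaneBoundaryHarmonic` (`𝔥₀`), `data` (`dat`), `dressing` (`U`: exit-kernel = discrete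
  harmonic extension into `faceDomain ∖ sideFaces` of the data on the side faces, `0` on all other
  outside faces — the lattice shadow of `E[h⁰ | η[0,τ]]`), `charDefect` (`dfc`, with the face-DGFF
  unit `κ₀ = √(π/2)` of `FaceDGFF.lean`), `defect` (`dft`).
* Proved: orientation, `left ≠ right`, `firstSideIndex`/`sideSign` API, a constant path has no
  side faces and zero dressing, `chordAngle` recursion and `= π/2` for a vertical first chord,
  `𝔥₀ = ±λ` on `ℝ±`, `blockSteps` bounds (`δ^{-1/2} ≤ bl δ`, `bl δ · δ ≤ √δ + δ`), INVARIANCE of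
  angle/data/dressing/defects under `w ↦ c·w` (`c > 0`), and `data_eight_thirds` (the cruxes'
  numerals verbatim). NOT here: discrete harmonicity of `dressing` off `sideFaces` (needs the
  one-step identity of `faceGreen`, unproved in `FaceDGFF.lean`); in a companion proof file (to keep
  the imports at the level of `FaceDGFF.lean`): the numerals are `igLambda/igLambdaPrime/igChi (8/3)`
  of `ImaginaryGeometryHarmonic.lean`, `bl δ → ∞`, `bl δ · δ → 0`, and the straight north-going
  path in `ℍ` (all chord angles `π/2`, data `∓λ'(−𝔥₀)` on its west/east banks; MS16 Fig. 1.10).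

## References

* J. Miller, S. Sheffield, *Imaginary geometry I: interacting SLEs*, PTRF 164 (2016),
  arXiv:1201.1496: Thm. 1.1, §1.2, Fig. 1.6, 1.9, 1.10. [MillerSheffield2016]
* G. F. Lawler, V. Limic, *Random Walk: A Modern Introduction* (2010), §4.6, §6.1 (exit
  distribution, discrete harmonic extension). [LawlerLimic2010]
* G. Grimmett, I. Manolescu, *Bond percolation on isoradial graphs* (2014), §2.1. [GrimmettManolescu2014]
-/

noncomputable section

open Complex Set MeasureTheory
open scoped Real

namespace Literature.Probability.RandomPlanarGeometry

open Literature.Probability.LatticeModels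

/-! ### Faces beside a directed lattice edge: orientation certificate for `squareLeftFace` -/

/-- **Left is counter-clockwise.** For a lattice edge `x → y` of `δℤ²` the centre of
`squareLeftFace x y` is `(X + Y)/2 + i (Y − X)/2` (`X = δx`, `Y = δy`): the midpoint of the edge
moved to the LEFT of the direction of travel. [cite: GrimmettManolescu2014, §2.1] -/
theorem faceCentre_squareLeftFace {x y : Site 2} (h : (zdGraph 2).Adj x y) (δ : ℝ) :
    faceCentre δ (squareLeftFace x y) =
      (meshPoint δ x + meshPoint δ y) / 2 + I * (meshPoint δ y - meshPoint δ x) / 2 := by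
  rcases zdGraph_two_adj_cases h with rfl | rfl | rfl | rfl
  · rw [squareLeftFace_east, faceCentre_eq]
    apply Complex.ext <;> simp [meshPoint] <;> ring
  · rw [squareLeftFace_north, faceCentre_eq]
    apply Complex.ext <;> simp [meshPoint] <;> ring
  · rw [squareLeftFace_west, faceCentre_eq]
    apply Complex.ext <;> simp [meshPoint] <;> ring
  · rw [squareLeftFace_south, faceCentre_eq]
    apply Complex.ext <;> simp [meshPoint] <;> ring

/-- **Right is clockwise.** The face `squareLeftFace y x` right of the edge `x → y` is centred at
`(X + Y)/2 − i (Y − X)/2`. [cite: GrimmettManolescu2014, §2.1] -/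
theorem faceCentre_squareLeftFace_symm {x y : Site 2} (h : (zdGraph 2).Adj x y) (δ : ℝ) :
    faceCentre δ (squareLeftFace y x) =
      (meshPoint δ x + meshPoint δ y) / 2 - I * (meshPoint δ y - meshPoint δ x) / 2 := by
  rw [faceCentre_squareLeftFace h.symm δ]
  ring

/-- The left and the right face of a lattice edge are different faces. [folklore] -/
theorem squareLeftFace_ne_squareLeftFace_symm {x y : Site 2} (h : (zdGraph 2).Adj x y) :
    squareLeftFace x y ≠ squareLeftFace y x := by
  intro heq
  have hc := congrArg (faceCentre 1) heq
  rw [faceCentre_squareLeftFace h, faceCentre_squareLeftFace_symm h] at hc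
  have hI : I * (meshPoint 1 y - meshPoint 1 x) = 0 := by linear_combination hc
  rcases mul_eq_zero.1 hI with hI0 | hsub
  · exact I_ne_zero hI0
  · refine h.ne (Site.toComplex_injective ?_)
    have hxy := (sub_eq_zero.1 hsub).symm
    simpa [meshPoint] using hxy

/-! ### Side faces of a vertex sequence -/

/-- `IsSideFace v i f` (the `let Ed`): step `i` of `v` is genuine (`v (i+1) ≠ v i`; the frozen tail
of a walk makes no steps) and `f` is the face on its left, `squareLeftFace (v i) (v (i+1))`, or on
its right, `squareLeftFace (v (i+1)) (v i)` — the lattice "two sides of `η[0,τ]`". [cite: MillerSheffield2016, Thm. 1.1 and §1.2 (Fig. 1.9)] -/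
def IsSideFace (v : ℕ → Site 2) (i : ℕ) (f : Site 2) : Prop :=
  v (i + 1) ≠ v i ∧ (f = squareLeftFace (v i) (v (i + 1)) ∨ f = squareLeftFace (v (i + 1)) (v i))

/-- The faces beside the path `v` (the `let K`): the data live on them, the field is harmonically
extended off them. [cite: MillerSheffield2016, Thm. 1.1 and §1.2 (Fig. 1.9)] -/
def sideFaces (v : ℕ → Site 2) : Set (Site 2) :=
  {f | ∃ i, IsSideFace v i f}

/-- Membership in `sideFaces`, unfolded. [folklore] -/
theorem mem_sideFaces_iff {v : ℕ → Site 2} {f : Site 2} :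
    f ∈ sideFaces v ↔ ∃ i, IsSideFace v i f :=
  Iff.rfl

/-- The left face of a genuine step is a side face. [folklore] -/
theorem squareLeftFace_mem_sideFaces {v : ℕ → Site 2} {i : ℕ} (h : v (i + 1) ≠ v i) :
    squareLeftFace (v i) (v (i + 1)) ∈ sideFaces v :=
  ⟨i, h, Or.inl rfl⟩

/-- The right face of a genuine step is a side face. [folklore] -/
theorem squareLeftFace_symm_mem_sideFaces {v : ℕ → Site 2} {i : ℕ} (h : v (i + 1) ≠ v i) :
    squareLeftFace (v (i + 1)) (v i) ∈ sideFaces v :=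
  ⟨i, h, Or.inr rfl⟩

/-- A constant sequence (no genuine step) has no side faces. [folklore] -/
theorem sideFaces_const (x : Site 2) : sideFaces (fun _ => x) = ∅ := by
  ext f
  simp [sideFaces, IsSideFace]

/-- The first step beside which `f` lies (the `let jf`; `sInf` over `ℕ`, junk `0` off
`sideFaces v`): the data on a face are frozen when the path first passes it. [cite: MillerSheffield2016, Thm. 1.1 and §1.2 (Fig. 1.9)] -/
def firstSideIndex (v : ℕ → Site 2) (f : Site 2) : ℕ :=
  sInf {i | IsSideFace v i f}

/-- For a side face, the first side index is a step beside which it lies. [folklore] -/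
theorem firstSideIndex_spec {v : ℕ → Site 2} {f : Site 2} (h : f ∈ sideFaces v) :
    IsSideFace v (firstSideIndex v f) f :=
  Nat.sInf_mem h

/-- The first side index is at most any step beside which the face lies. [folklore] -/
theorem firstSideIndex_le {v : ℕ → Site 2} {f : Site 2} {i : ℕ} (h : IsSideFace v i f) :
    firstSideIndex v f ≤ i :=
  Nat.sInf_le h

/-- Off `sideFaces v` the first side index is the junk value `0`. [folklore] -/
theorem firstSideIndex_of_not_mem {v : ℕ → Site 2} {f : Site 2} (h : f ∉ sideFaces v) :
    firstSideIndex v f = 0 := by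
  rw [firstSideIndex, Nat.sInf_eq_zero]
  refine Or.inr (Set.ext fun i => ?_)
  simp only [Set.mem_setOf_eq, Set.mem_empty_iff_false, iff_false]
  exact fun hi => h ⟨i, hi⟩

/-- The side sign of `f` along `v` (the `let sg` / the `if … then −1 else 1` of `dat`): `−1` if at
its first side index `f` is the LEFT face of the step, `+1` otherwise (right face; junk `+1` off
`sideFaces v`) — the sign of `∓λ'`, "`−λ'` … on the left and `λ'` … on the right". [cite: MillerSheffield2016, §1.2 (Fig. 1.9) and Thm. 1.1] -/
def sideSign (v : ℕ → Site 2) (f : Site 2) : ℝ :=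
  if f = squareLeftFace (v (firstSideIndex v f)) (v (firstSideIndex v f + 1)) then -1 else 1

/-- The side sign is `−1` or `+1`. [folklore] -/
theorem sideSign_eq_neg_one_or_eq_one (v : ℕ → Site 2) (f : Site 2) :
    sideSign v f = -1 ∨ sideSign v f = 1 := by
  unfold sideSign
  split_ifs
  · exact Or.inl rfl
  · exact Or.inr rfl

/-- On the left face of its first step the side sign is `−1`. [folklore] -/
theorem sideSign_of_eq_squareLeftFace {v : ℕ → Site 2} {f : Site 2}
    (h : f = squareLeftFace (v (firstSideIndex v f)) (v (firstSideIndex v f + 1))) :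
    sideSign v f = -1 := by
  rw [sideSign, if_pos h]

/-- On the right face of its first step — a lattice step, so that the two side faces differ — the
side sign is `+1`. [folklore] -/
theorem sideSign_of_eq_squareLeftFace_symm {v : ℕ → Site 2} {f : Site 2}
    (hadj : (zdGraph 2).Adj (v (firstSideIndex v f)) (v (firstSideIndex v f + 1)))
    (h : f = squareLeftFace (v (firstSideIndex v f + 1)) (v (firstSideIndex v f))) :
    sideSign v f = 1 := by
  rw [sideSign, if_neg]
  intro heq
  exact squareLeftFace_ne_squareLeftFace_symm hadj (heq.symm.trans h)

/-! ### The mesoscopic block length -/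

/-- The route's block length `⌈δ^{-1/2}⌉` lattice steps (the `let bl`): chords of that many steps
have length `≲ √δ → 0` and contain `→ ∞` steps. [folklore] -/
def blockSteps (δ : ℝ) : ℕ :=
  ⌈(Real.sqrt δ)⁻¹⌉₊

/-- `δ^{-1/2} ≤ blockSteps δ`. [folklore] -/
theorem inv_sqrt_le_blockSteps (δ : ℝ) : (Real.sqrt δ)⁻¹ ≤ blockSteps δ :=
  Nat.le_ceil _

/-- `blockSteps δ > 0` for `δ > 0`. [folklore] -/
theorem blockSteps_pos {δ : ℝ} (hδ : 0 < δ) : 0 < blockSteps δ :=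
  Nat.ceil_pos.2 (inv_pos.2 (Real.sqrt_pos.2 hδ))

/-- `blockSteps δ < δ^{-1/2} + 1`. [folklore] -/
theorem blockSteps_lt (δ : ℝ) : (blockSteps δ : ℝ) < (Real.sqrt δ)⁻¹ + 1 :=
  Nat.ceil_lt_add_one (inv_nonneg.2 (Real.sqrt_nonneg δ))

/-- The chords are mesoscopic: `blockSteps δ · δ ≤ √δ + δ`. [folklore] -/
theorem blockSteps_mul_le {δ : ℝ} (hδ : 0 < δ) : (blockSteps δ : ℝ) * δ ≤ Real.sqrt δ + δ := by
  have hs : 0 < Real.sqrt δ := Real.sqrt_pos.2 hδ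
  have hsq : Real.sqrt δ * Real.sqrt δ = δ := Real.mul_self_sqrt hδ.le
  calc (blockSteps δ : ℝ) * δ ≤ ((Real.sqrt δ)⁻¹ + 1) * δ := by gcongr; exact (blockSteps_lt δ).le
    _ = Real.sqrt δ + δ := by field_simp; nlinarith [hsq]

/-! ### The half-plane harmonic function with data `∓λ` -/

/-- `𝔥₀(z) = λ − (2λ/π) arg z`: the bounded harmonic function on `ℍ` with boundary values `−λ` on
`(−∞,0)` and `λ` on `(0,∞)` — the mean of the GFF whose flow line from `0` is chordal SLE_κ when
`λ = π/√κ`. Subtracting `𝔥₀ ∘ w` turns flow-line data for `h` into data for the zero-boundary field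
`h⁰ = h − 𝔥₀`. [cite: MillerSheffield2016, Thm. 1.1 and Fig. 1.10] -/
def halfPlaneBoundaryHarmonic (lam : ℝ) (z : ℂ) : ℝ :=
  lam - (2 * lam / π) * arg z

/-- Boundary value `λ` on `(0, ∞)`. [cite: MillerSheffield2016, Fig. 1.10] -/
theorem halfPlaneBoundaryHarmonic_ofReal_pos (lam : ℝ) {x : ℝ} (hx : 0 < x) :
    halfPlaneBoundaryHarmonic lam x = lam := by
  rw [halfPlaneBoundaryHarmonic, arg_ofReal_of_nonneg hx.le]
  ring

/-- Boundary value `−λ` on `(−∞, 0)`. [cite: MillerSheffield2016, Fig. 1.10] -/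
theorem halfPlaneBoundaryHarmonic_ofReal_neg (lam : ℝ) {x : ℝ} (hx : x < 0) :
    halfPlaneBoundaryHarmonic lam x = -lam := by
  rw [halfPlaneBoundaryHarmonic, arg_ofReal_of_neg hx]
  field_simp
  ring

/-- `𝔥₀` is invariant under dilations of `ℍ`. [folklore] -/
theorem halfPlaneBoundaryHarmonic_real_mul (lam : ℝ) {c : ℝ} (hc : 0 < c) (z : ℂ) :
    halfPlaneBoundaryHarmonic lam (c * z) = halfPlaneBoundaryHarmonic lam z := by
  rw [halfPlaneBoundaryHarmonic, halfPlaneBoundaryHarmonic, arg_real_mul _ hc]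

/-! ### The frame: constants, chart, domain, mesh, block length -/

/-- The fixed data of a flow-line dressing (everything the cruxes' `let`s `pt/ang/dat/U/dfc/dft`
close over): the imaginary-geometry constants `λ, λ', χ` AS PARAMETERS (`κ = 8/3`:
`π√(3/8), π/√6, 1/√6`; `κ = 2`: `π/√2, π√2/4, 1/√2`; in general `π/√κ, π√κ/4, 2/√κ − √κ/2`), the
`ℍ`-chart `chart : ℂ → ℂ` (the inverse `φ.symm` of a chordal uniformizer `φ : ℍ → D`), the planar
domain, the mesh `δ` and the chord block length `m` (`blockSteps δ` in the route).
[cite: MillerSheffield2016, Thm. 1.1 and §1.2 (Fig. 1.9–1.10)] -/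
structure FlowLineFrame where
  /-- `λ` (`= π/√κ`): the boundary data `∓λ` of the field on the two boundary arcs. -/
  lam : ℝ
  /-- `λ'` (`= λ − πχ/2`): the data `∓λ'` on the two sides of a vertical flow line. -/
  lam' : ℝ
  /-- `χ` (`= 2/√κ − √κ/2`): the coefficient of the winding. -/
  chi : ℝ
  /-- The `ℍ`-chart in which angles are read (`φ.symm` for a chordal uniformizer `φ`). -/
  chart : ℂ → ℂ
  /-- The planar domain `Ω` whose discretisation `Ω_δ` carries the faces (`D.carrier`). -/
  domain : Set ℂ
  /-- The mesh `δ`. -/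
  mesh : ℝ
  /-- The number of lattice steps per chord (`blockSteps δ` in the route; `0` is a junk regime in
  which all chords degenerate to a point and every face reads the block `0`). -/
  block : ℕ

namespace FlowLineFrame

variable (Φ : FlowLineFrame)

/-- The `i`-th chord vertex of `v` (the `let pt`): every `m`-th vertex, placed on `δℤ²` and read
in the chart. [cite: MillerSheffield2016, §1.2 (Fig. 1.6, 1.9)] -/
def chordVertex (v : ℕ → Site 2) (i : ℕ) : ℂ :=
  Φ.chart (meshPoint Φ.mesh (v (Φ.block * i)))

/-- **The lifted tangent angle of the `B`-th chord** (the `let ang`):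
`π/2 + arg((p₁ − p₀)/i) + Σ_{i<B} arg((p_{i+2} − p_{i+1})/(p_{i+1} − p_i))`. The first chord is read
relative to the upward vertical ("`η` starts out in the vertical direction, so that the winding
number is approximately `π/2`"; a chord entering `ℍ` has `arg((p₁ − p₀)/i) ∈ (−π/2, π/2)`), every
later chord adds its principal turning angle; `ang − π/2` is the net winding as a real number
(degenerate chords contribute `arg 0 = 0`). [cite: MillerSheffield2016, §1.2 (arXiv text pp. 6–7)] -/
def chordAngle (v : ℕ → Site 2) (B : ℕ) : ℝ :=
  π / 2 + arg ((Φ.chordVertex v 1 - Φ.chordVertex v 0) / I) +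
    ∑ i ∈ Finset.range B, arg ((Φ.chordVertex v (i + 2) - Φ.chordVertex v (i + 1)) /
      (Φ.chordVertex v (i + 1) - Φ.chordVertex v i))

/-- The angle of the first chord. [folklore] -/
theorem chordAngle_zero (v : ℕ → Site 2) :
    Φ.chordAngle v 0 = π / 2 + arg ((Φ.chordVertex v 1 - Φ.chordVertex v 0) / I) := by
  simp [chordAngle]

/-- Lifting along the chord sequence: the next chord adds its turning angle. [folklore] -/
theorem chordAngle_succ (v : ℕ → Site 2) (B : ℕ) :
    Φ.chordAngle v (B + 1) = Φ.chordAngle v B +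
      arg ((Φ.chordVertex v (B + 2) - Φ.chordVertex v (B + 1)) /
        (Φ.chordVertex v (B + 1) - Φ.chordVertex v B)) := by
  simp [chordAngle, Finset.sum_range_succ, add_assoc]

/-- A first chord pointing straight up in the chart has angle `π/2`. [cite: MillerSheffield2016, §1.2 (arXiv text p. 6)] -/
theorem chordAngle_zero_of_vertical {v : ℕ → Site 2} {r : ℝ} (hr : 0 ≤ r)
    (h : Φ.chordVertex v 1 - Φ.chordVertex v 0 = r * I) : Φ.chordAngle v 0 = π / 2 := by
  rw [chordAngle_zero, h, mul_div_assoc, div_self I_ne_zero, mul_one, arg_ofReal_of_nonneg hr,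
    add_zero]

/-- **The flow-line data on a side face** (the `let dat`): with `j = firstSideIndex v f`,
`Φ.data v f = sideSign v f · λ' + χ · (Φ.chordAngle v (j / m) − π/2) − 𝔥₀(chart (centre f))` —
"`−λ'` plus the winding on the left and `λ'` plus the winding on the right", winding of the chord
through the first step beside `f`, re-expressed for the ZERO-boundary field by subtracting
`𝔥₀ ∘ chart`; junk off `sideFaces v`. [cite: MillerSheffield2016, Thm. 1.1 and §1.2 (Fig. 1.9–1.10)] -/
def data (v : ℕ → Site 2) (f : Site 2) : ℝ :=
  sideSign v f * Φ.lam' + Φ.chi * (Φ.chordAngle v (firstSideIndex v f / Φ.block) - π / 2) -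
    halfPlaneBoundaryHarmonic Φ.lam (Φ.chart (faceCentre Φ.mesh f))

open scoped Classical in
/-- **The flow-line dressing of `v`** at the face `z` (the `let U`):
`Σ_{f ∈ sideFaces v} faceExit (faceDomain Ω δ ∖ sideFaces v) z f · Φ.data v f` — the discrete
harmonic extension into the slit face domain (exit kernel of the walk on faces killed off it) of the
data on the faces beside the path and `0` on every other outside face: the lattice shadow of
`E[h⁰ | η[0,τ]]` ("given the path, a GFF on the slit domain with flow-line boundary data"). A `tsum`
supported on `sideFaces v` (junk `0` if not summable). [cite: MillerSheffield2016, Thm. 1.1 and §1.2 (Fig. 1.9)] -/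
def dressing (v : ℕ → Site 2) (z : Site 2) : ℝ :=
  ∑' f : Site 2, if f ∈ sideFaces v then
    faceExit (faceDomain Φ.domain Φ.mesh \ sideFaces v) z f * Φ.data v f else 0

/-- **The characteristic-function defect** (the `let dfc`): for a test function `ψ`, `s ∈ ℝ`, a
path `v` and a field `h`, `exp(i s κ₀⟨h,ψ⟩_δ) − exp(i s ⟨U^v,ψ⟩_δ − s²(π/2)⟨ψ, G_{Fc∖K} ψ⟩_δ/2)`,
`κ₀ = √(π/2)` the unit of the face DGFF (`FaceDGFF.lean`): its conditional mean vanishes exactly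
when, given the path, `κ₀⟨h,ψ⟩_δ ∼ N(⟨U^v,ψ⟩_δ, (π/2)⟨ψ,G_{slit}ψ⟩_δ)` — the hypothesis of
[MS16, Thm. 1.1] at a lattice time. [cite: MillerSheffield2016, Thm. 1.1] -/
def charDefect (ψ : ℂ → ℝ) (s : ℝ) (v : ℕ → Site 2) (h : Site 2 → ℝ) : ℂ :=
  Complex.exp (I * (s * Real.sqrt (π / 2) * facePairing Φ.domain Φ.mesh ψ h : ℝ)) -
    Complex.exp (I * (s * facePairing Φ.domain Φ.mesh ψ (Φ.dressing v) : ℝ) -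
      ((s ^ 2 * (π / 2) * faceQuadForm Φ.domain Φ.mesh ψ (faceDomain Φ.domain Φ.mesh \ sideFaces v)
        / 2 : ℝ) : ℂ))

/-- **The dressing defect of a kernel** (the `let dft`): for kernels `Kr ξ` (field measures indexed
by `ξ : ι`) and prefix maps `pre ξ k` (the path `ξ` frozen at time `k`), the supremum over prefix
times `k` and prefix functionals `|F| ≤ 1` of `‖Σ'_ξ ∫ F(pre ξ k) · charDefect ψ s (pre ξ k) h dKr_ξ(h)‖`;
"the coupling dresses the field well" iff this tends to `0`. (`sSup` in `ℝ`: junk `0` for an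
unbounded set; inner `tsum` junk `0` if not summable.) [cite: MillerSheffield2016, Thm. 1.1] -/
def defect {ι : Type*} (ψ : ℂ → ℝ) (s : ℝ) (pre : ι → ℕ → ℕ → Site 2)
    (Kr : ι → Measure (Site 2 → ℝ)) : ℝ :=
  sSup {r : ℝ | ∃ (k : ℕ) (F : (ℕ → Site 2) → ℝ), (∀ u, |F u| ≤ 1) ∧
    r = ‖∑' ξ : ι, ∫ h, (F (pre ξ k) : ℂ) * Φ.charDefect ψ s (pre ξ k) h ∂(Kr ξ)‖}

/-- A path without genuine steps dresses nothing: `U ≡ 0` for a constant sequence. [folklore] -/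
theorem dressing_const (x z : Site 2) : Φ.dressing (fun _ => x) z = 0 := by
  simp [dressing, sideFaces_const]

/-! ### Invariance under dilations of the chart (`φ ↦ φ ∘ (c ·)`, i.e. `φ.symm ↦ c⁻¹ φ.symm`) -/

/-- The frame with the chart multiplied by the real constant `c`. [folklore] -/
def smulChart (c : ℝ) : FlowLineFrame :=
  { Φ with chart := fun z => (c : ℂ) * Φ.chart z }

/-- Chord vertices are multiplied by `c`. [folklore] -/
@[simp] theorem smulChart_chordVertex (c : ℝ) (v : ℕ → Site 2) (i : ℕ) :
    (Φ.smulChart c).chordVertex v i = c * Φ.chordVertex v i := rfl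

/-- Chord angles do not see dilations of `ℍ`. [folklore] -/
theorem smulChart_chordAngle {c : ℝ} (hc : 0 < c) (v : ℕ → Site 2) (B : ℕ) :
    (Φ.smulChart c).chordAngle v B = Φ.chordAngle v B := by
  have hc' : (c : ℂ) ≠ 0 := ofReal_ne_zero.2 hc.ne'
  simp only [chordAngle, smulChart_chordVertex, ← mul_sub, mul_div_mul_left _ _ hc']
  rw [mul_div_assoc, arg_real_mul _ hc]

/-- The data do not see dilations of `ℍ`. [folklore] -/
theorem smulChart_data {c : ℝ} (hc : 0 < c) (v : ℕ → Site 2) (f : Site 2) :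
    (Φ.smulChart c).data v f = Φ.data v f := by
  simp only [data, smulChart_chordAngle Φ hc]
  simp only [smulChart, halfPlaneBoundaryHarmonic_real_mul _ hc]

/-- **The dressing does not see dilations of `ℍ`**: two chordal uniformizers of `(D; a, b)` (which
differ by a dilation) dress every path identically. [folklore] -/
theorem smulChart_dressing {c : ℝ} (hc : 0 < c) (v : ℕ → Site 2) (z : Site 2) :
    (Φ.smulChart c).dressing v z = Φ.dressing v z := by
  simp only [dressing, smulChart_data Φ hc]
  rfl

/-- The defects do not see dilations of `ℍ`. [folklore] -/
theorem smulChart_charDefect {c : ℝ} (hc : 0 < c) (ψ : ℂ → ℝ) (s : ℝ) (v : ℕ → Site 2)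
    (h : Site 2 → ℝ) : (Φ.smulChart c).charDefect ψ s v h = Φ.charDefect ψ s v h := by
  have hd : (Φ.smulChart c).dressing v = Φ.dressing v := funext (Φ.smulChart_dressing hc v)
  simp only [charDefect, hd]
  rfl

/-- The kernel defect does not see dilations of `ℍ`. [folklore] -/
theorem smulChart_defect {ι : Type*} {c : ℝ} (hc : 0 < c) (ψ : ℂ → ℝ) (s : ℝ)
    (pre : ι → ℕ → ℕ → Site 2) (Kr : ι → Measure (Site 2 → ℝ)) :
    (Φ.smulChart c).defect ψ s pre Kr = Φ.defect ψ s pre Kr := by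
  simp only [defect, smulChart_charDefect Φ hc]

/-! ### The cruxes' numerals (`κ = 8/3`) -/

/-- **Verbatim form of the cruxes' `dat`.** With the constants `(π√(3/8), π/√6, 1/√6)` of
`κ = 8/3` the data read
`(∓1)·(π/√6) + (1/√6)·(ang − π/2) − π√(3/8) + 2√(3/8)·arg(chart(centre f))`, as inlined in
`LatticeFlowLine` / `FlowLineStability` / `GaussianDressing` of route `SAWDiscreteFlowLine`.
[cite: MillerSheffield2016, Thm. 1.1 and §1.2 (Fig. 1.9–1.10)] -/
theorem data_eight_thirds (w : ℂ → ℂ) (Ω : Set ℂ) (δ : ℝ) (m : ℕ) (v : ℕ → Site 2) (f : Site 2) :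
    (⟨π * Real.sqrt (3 / 8), π / Real.sqrt 6, 1 / Real.sqrt 6, w, Ω, δ, m⟩ : FlowLineFrame).data v f =
      sideSign v f * (π / Real.sqrt 6) +
        1 / Real.sqrt 6 *
          ((⟨π * Real.sqrt (3 / 8), π / Real.sqrt 6, 1 / Real.sqrt 6, w, Ω, δ, m⟩ :
              FlowLineFrame).chordAngle v (firstSideIndex v f / m) - π / 2) -
        π * Real.sqrt (3 / 8) + 2 * Real.sqrt (3 / 8) * arg (w (faceCentre δ f)) := by
  simp only [data, halfPlaneBoundaryHarmonic]
  have hπ : (π : ℝ) ≠ 0 := Real.pi_ne_zero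
  field_simp
  ring

end FlowLineFrame

end Literature.Probability.RandomPlanarGeometry
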